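import Literature.MathematicalPhysics.QuantumFieldTheory.Balaban1983to89.T3PrintedRegularMinimiser
import HarnessLib

/-!
# `Balaban1983to89.T3LogComparisonSocket` — rung R3, crux K1bR-pr «FluctuationComparisonRegPr» (stmt-QuantumFields-19201), stub
# `stub_logComparisonRegPr` (K1-(ii)): THE TWO NAMED SOCKETS — the per-run two-sided small-field representation at the trivial history
# ([Balaban1985UV3] (41) ∧ (47), PINNED, with the interaction data EXPOSED as arguments) and the cut-off-Cauchy property of the interaction
# terms ([King1986] Thm 3.4 shape); the bookkeeping «representation ∧ Cauchy ⇒ the registered stub text» is summit-side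

Cell `ym3-torus` (rung R3), fleet seat `ym-ust-19201-p2` (gen 0); split card of record `CARD-19201-logComparison-split.md` (evidence #16 on
stmt-QuantumFields-19201; sub-lemmas S-D, S-E, S-F) = the route owner's brief `K1ii-OWNER-BRIEF-logComparisonRegPr.md` (evidence #17; (R1), (R2),
(R3)) piece for piece; owner ruling 2026-08-26T12:55:11Z (B)(ii)–(iii).  WHAT THIS IS NOT: no estimate of Bałaban's or King's is asserted — §1 are
hypothesis SCHEMAS (never asserted).  Nothing here constructs the interaction terms: they are ARGUMENTS.

WHY THE DATA ARE ARGUMENTS (the «LINE №57 trap», fleet findings af2a5b6fdc02c5ee / f41562e676b689b4): the located content of the stub is the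
two-run comparison of Bałaban's small-field interaction terms `Σ_j Σ_Y 𝒫_j(Y; U_k(V))` of (41)/(43).  If those terms were ∃-bound inside a
representation schema, the schema would be satisfiable by `Pint := log ρ + β·minActionRegPr` and every comparison statement would silently become
the whole crux.  Hence both schemas take the SAME explicit data
`Pint : (K n : ℕ) → GaugeField (F.P n) 0 SU(2) → ℝ` (run `K`'s interaction sum at the comparison height `n`, i.e. after `k = K − n` steps, read on
`(F.P n)₀`), `E : ℕ → ℕ → ℝ` (the constants `E_k` of (41), (64)) and `Rm : ℕ → ℕ → ℝ` (the remainders `Σ_{j<k} O((L^jε)^{3+κ₀})|T₁^{(j)}|` of (41)/(47)),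
to be instantiated the day the pinned (41)-data exist as definitions (ledger `defn-AlphaInputsT3AC`, shape spec `AlphaInputsT3AC-SHAPE.md`
79ec68554fb53705: `PintT3`, `EcstT3`, `RmT3`).

* §1 `TwoSidedRepAt F γ b₀ p₀ ε₀ Pint E Rm` — (41) ∧ (47) AT THE TRIVIAL HISTORY for the route's pinned objects: for every run `K` and every
  comparison height `n ≤ K`, a.e. on the `θBal(n)`-small data `V` at which the restricted height density `ρ = heightDensity … (histGood K n)` is
  positive, `|log ρ(V) + β_K·minActionRegPr_{n,K}(V) − Pint K n V + E K n| ≤ Rm K n`; `Rm ≥ 0` and `Σ_K (Rm K ⌊K/m⌋ + Rm (K+1) ⌊K/m⌋) < ∞` for every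
  `m ≥ 1` (print: `Rm_k = O((L^kε)^{κ₀})|T|`, geometric along `n = ⌊K/m⌋`).  `PintCauchyAt F γ b₀ p₀ m Pint` — [King1986] Thm 3.4 for the SAME data:
  `Σ_K r′_K < ∞` and constants `c_K` with `|Pint (K+1) ⌊K/m⌋ V − Pint K ⌊K/m⌋ V − c_K| ≤ r′_K` a.e. on the same small data (positivity guards kept).
* The bookkeeping «(∀-prefixed) `TwoSidedRepAt` ∧ `PintCauchyAt` ⇒ THE REGISTERED TEXT OF `stub_logComparisonRegPr` VERBATIM» is the summit-side
  theorem `Summit.QuantumFields.YangMills.Theorems.LogComparisonSocket.logComparisonRegPr_of_rep_of_cauchy`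
  (`Summits/QuantumFields/YangMills/Theorems/UnitScaleTiltFluctuationComparisonRegPrSocket.lean`); this file is statements only
  (plus the two definitional readings `bgRegPr_eq` / `bgRegPr'_eq` at the heights the stub uses).

References: T. Bałaban, CMP 102 (1985) 255–275 [Balaban1985UV3] ((41) p.266, (43) p.266, (47) p.267, (62)–(65) pp.271–273); C. King, CMP 102 (1986)
649–677 [King1986] (§3.2 p.656, Thm 3.4 (3.9) p.656, (3.12)–(3.13) p.657, Props 3.8–3.10 pp.664–669).
-/

noncomputable section

open MeasureTheory Filter Topology
open Literature.MathematicalPhysics.QuantumFieldTheory.Balaban1983to89.T3ContinuumYM3Torus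
open Literature.MathematicalPhysics.QuantumFieldTheory.Balaban1983to89.T3UnitLawDensityEML (ℰp measurableE_ℰp)
open Literature.MathematicalPhysics.QuantumFieldTheory.Balaban1983to89.T3UnitScaleTilt
open Literature.MathematicalPhysics.QuantumFieldTheory.Balaban1983to89.T3TiltDescent
open Literature.MathematicalPhysics.QuantumFieldTheory.Balaban1983to89.T3PrintedRegularMinimiser
open Literature.MathematicalPhysics.QuantumFieldTheory.Balaban1983to89.Missing

namespace Literature.MathematicalPhysics.QuantumFieldTheory.Balaban1983to89.T3LogComparisonSocket

/-! ## §1 The two sockets (hypothesis schemas, never asserted; the interaction data are arguments) -/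

section Schemas

variable (F : T3Family) (γ b₀ p₀ : ℝ)

/-- **(41) ∧ (47) AT THE TRIVIAL HISTORY, PINNED, WITH THE INTERACTION DATA EXPOSED** (hypothesis schema, never asserted): for every run `K`
and comparison height `n ≤ K`, a.e. on the `θBal(n)`-small data `V` with positive restricted height density on the UV-small history `histGood K n`,
`|log ρ^{(K)}_{K−n}(V) + β_K·minActionRegPr_{n,K}(V) − Pint K n V + E K n| ≤ Rm K n` — [Balaban1985UV3] (41) (upper; at the trivial history the
large-field sum collapses to its single all-small term) and (47) (lower) share the exponent `−(1/g_k²)A^η(U_k) + Σ_jΣ_Y𝒫_j(Y_j,U_k) − E_k` and differ by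
`± Σ_{j<k}O((L^jε)^{3+κ₀})|T₁^{(j)}|`; here `β_K·minActionRegPr` is print's background action (the minimum over the two-clause space (6) of
[Balaban1985Variational]), `Pint` the interaction sum (43), `E` the constants (64), `Rm` the remainders, the last two `V`-independent; plus the printed
SIZE of the remainders in the only form used downstream: `Rm ≥ 0` and summable along every free fraction `n = ⌊K/m⌋`, `m ≥ 1` (`Rm_k = O((L^kε)^{κ₀})|T|`).
[cite: Balaban1985UV3, (41) p.266 and (47) p.267] -/
def TwoSidedRepAt (ε₀ : ℝ) (Pint : (K n : ℕ) → GaugeField (F.P n) 0 (Matrix.specialUnitaryGroup (Fin 2) ℂ) → ℝ) (E Rm : ℕ → ℕ → ℝ) : Prop :=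
  (∀ K n, 0 ≤ Rm K n) ∧
  (∀ m : ℕ, 0 < m → Summable fun K : ℕ => Rm K (K / m) + Rm (K + 1) (K / m)) ∧
  ∀ (K n : ℕ) (h : n ≤ K), ∀ᵐ V ∂fieldMeasure (F.P n) 0 (Matrix.specialUnitaryGroup (Fin 2) ℂ),
    PlaqSmall (θBal F.L γ b₀ p₀ n) V →
      0 < heightDensity F γ h (histGood F ℰp (θBal F.L γ b₀ p₀) K n) V → |Real.log (heightDensity F γ h (histGood F ℰp (θBal F.L γ b₀ p₀) K n) V) +
            (F.scheme ℰp γ).β K * minActionRegPr F n K h ε₀ V - Pint K n V + E K n| ≤ Rm K n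

/-- **THE CUT-OFF-CAUCHY PROPERTY OF THE INTERACTION TERMS** (hypothesis schema, never asserted; [King1986] Thm 3.4 (3.9) for Bałaban's
small-field interaction sums of two CONSECUTIVE cut-offs, non-abelian d = 3 — located, unprinted): summable radii `r′_K ≥ 0` and constants `c_K` such
that for every cut-off `K`, with `n = ⌊K/m⌋` free top steps, a.e. on the `θBal(n)`-small data at which both runs' restricted height densities are
positive, `|Pint (K+1) n V − Pint K n V − c_K| ≤ r′_K` (print's error `C(L^{−γk}(L^kε)^{−β} + (L^kε)^{σ})|T|`, `k = K − n`, summable for `m ≥ m₀`).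
[cite: King1986, Thm 3.4 (3.9) p.656] -/
def PintCauchyAt (m : ℕ) (Pint : (K n : ℕ) → GaugeField (F.P n) 0 (Matrix.specialUnitaryGroup (Fin 2) ℂ) → ℝ) : Prop :=
  ∃ (r' c : ℕ → ℝ), Summable r' ∧ (∀ K, 0 ≤ r' K) ∧
    ∀ K, ∀ᵐ V ∂fieldMeasure (F.P (K / m)) 0 (Matrix.specialUnitaryGroup (Fin 2) ℂ),
      PlaqSmall (θBal F.L γ b₀ p₀ (K / m)) V →
        0 < heightDensity F γ (Nat.div_le_self K m) (histGood F ℰp (θBal F.L γ b₀ p₀) K (K / m)) V →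
        0 < heightDensity F γ ((Nat.div_le_self K m).trans (Nat.le_succ K))
              (histGood F ℰp (θBal F.L γ b₀ p₀) (K + 1) (K / m)) V → |Pint (K + 1) (K / m) V - Pint K (K / m) V - c K| ≤ r' K

variable {F γ b₀ p₀}

/-- The representation schema read at run `K` and height `⌊K/m⌋` speaks about `bgRegPr` (definitional). [cite: Balaban1985UV3, (41) p.266] -/
theorem bgRegPr_eq (m : ℕ) (ε₀ : ℝ) (K : ℕ) (V : GaugeField (F.P (K / m)) 0 (Matrix.specialUnitaryGroup (Fin 2) ℂ)) :
    bgRegPr F γ m ε₀ K V = (F.scheme ℰp γ).β K * minActionRegPr F (K / m) K (Nat.div_le_self K m) ε₀ V :=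
  rfl

/-- … and at run `K+1`, same height, about `bgRegPr'` (definitional). [cite: Balaban1985UV3, (41) p.266] -/
theorem bgRegPr'_eq (m : ℕ) (ε₀ : ℝ) (K : ℕ) (V : GaugeField (F.P (K / m)) 0 (Matrix.specialUnitaryGroup (Fin 2) ℂ)) :
    bgRegPr' F γ m ε₀ K V =
      (F.scheme ℰp γ).β (K + 1) * minActionRegPr F (K / m) (K + 1) ((Nat.div_le_self K m).trans (Nat.le_succ K)) ε₀ V :=
  rfl

end Schemas

/-! ## §1b The cut-off-Cauchy socket resolved LEVEL BY LEVEL (King's replacement scheme at the granularity of RG steps)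

[King1986] proves Thm 3.4 by writing the effective action as a sum over the renormalisation steps and replacing, one step at a time, the
objects of the run with more steps by those of the run with fewer (§3.4–3.6 pp.658–670; Props 3.8–3.10).  At the granularity of STEPS this is:
run `K` at height `n` has `k = K − n` steps `j = 0,…,k−1` (step `j` acts at physical spacing `L^{j−K}`), run `K+1` has `k+1` steps `j′ = 0,…,k`; step
`j` of run `K` is MATCHED with step `j+1` of run `K+1` (same physical spacing), and step `0` of run `K+1` (the extra finest slice) is unmatched.  The schema
below asks, for per-step interaction data `P K j n` (the step-`j` part of `Pint K n`, an ARGUMENT, to be instantiated by `Σ_Y PjT3 …`), a summable budget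
for the matched differences and for the `V`-dependence of the extra slice; `Summit.….LogComparisonSocketLevels.pintCauchyAt_of_levelwise` assembles it
into `PintCauchyAt` for `Pint K n := Σ_{j<K−n} P K j n`. -/

section Levels

variable (F : T3Family) (γ b₀ p₀ : ℝ)

/-- **THE CUT-OFF-CAUCHY PROPERTY, LEVEL BY LEVEL** (hypothesis schema, never asserted; [King1986] §3.4–3.6 replacement scheme read at the granularity
of renormalisation steps, for Bałaban's per-step interaction sums — located, unprinted for non-abelian d = 3): per-step data `P K j n : (F.P n)₀-fields → ℝ`
(step `j < K − n` of run `K`, read at the comparison height `n`); budgets `δ₀ K ≥ 0` for the `V`-dependence of run `K+1`'s EXTRA finest step and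
`δ K j ≥ 0` for the MATCHED pairs (run `K+1` step `j+1` vs run `K` step `j`), constants `c₀ K`, `c K j`, with `Σ_K (δ₀ K + Σ_{j<K−⌊K/m⌋} δ K j) < ∞`, and
the two a.e. comparisons on the `θBal(⌊K/m⌋)`-small data where both restricted height densities are positive. [cite: King1986, Thm 3.4 (3.9) p.656] -/
def LevelCauchyAt (m : ℕ) (P : (K j n : ℕ) → GaugeField (F.P n) 0 (Matrix.specialUnitaryGroup (Fin 2) ℂ) → ℝ) : Prop :=
  ∃ (δ c : ℕ → ℕ → ℝ) (δ₀ c₀ : ℕ → ℝ), (∀ K j, 0 ≤ δ K j) ∧ (∀ K, 0 ≤ δ₀ K) ∧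
    (Summable fun K : ℕ => δ₀ K + ∑ j ∈ Finset.range (K - K / m), δ K j) ∧
    (∀ K, ∀ᵐ V ∂fieldMeasure (F.P (K / m)) 0 (Matrix.specialUnitaryGroup (Fin 2) ℂ),
      PlaqSmall (θBal F.L γ b₀ p₀ (K / m)) V →
        0 < heightDensity F γ (Nat.div_le_self K m) (histGood F ℰp (θBal F.L γ b₀ p₀) K (K / m)) V →
        0 < heightDensity F γ ((Nat.div_le_self K m).trans (Nat.le_succ K))
              (histGood F ℰp (θBal F.L γ b₀ p₀) (K + 1) (K / m)) V → |P (K + 1) 0 (K / m) V - c₀ K| ≤ δ₀ K) ∧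
    (∀ K, ∀ j < K - K / m, ∀ᵐ V ∂fieldMeasure (F.P (K / m)) 0 (Matrix.specialUnitaryGroup (Fin 2) ℂ),
      PlaqSmall (θBal F.L γ b₀ p₀ (K / m)) V →
        0 < heightDensity F γ (Nat.div_le_self K m) (histGood F ℰp (θBal F.L γ b₀ p₀) K (K / m)) V →
        0 < heightDensity F γ ((Nat.div_le_self K m).trans (Nat.le_succ K))
              (histGood F ℰp (θBal F.L γ b₀ p₀) (K + 1) (K / m)) V → |P (K + 1) (j + 1) (K / m) V - P K j (K / m) V - c K j| ≤ δ K j)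

end Levels

end Literature.MathematicalPhysics.QuantumFieldTheory.Balaban1983to89.T3LogComparisonSocket

end
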